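import Literature.MeasureTheory.Hausdorff.EuclideanHausdorffComparison
import HarnessLib

/-!
# Small caps of round spheres are asymptotically flat discs, for Mathlib's `μH[d]`

For the unit sphere `S^d = {‖y‖ = 1}` of a `(d+1)`-dimensional real inner product space `E`
(`d ≥ 1`), a point `x ∈ S^d` and a CHORDAL radius `0 < r < √2`, the cap `S^d ∩ B(x, r)` is compared
with the flat `d`-disc `B(0, r) ⊆ EuclideanSpace ℝ (Fin d)` of the same radius, for Mathlib's
un-normalised Hausdorff measure `μH[d]`:

* `mul_hausdorffMeasure_ball_le_unitSphere_inter_ball`,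
  `hausdorffMeasure_unitSphere_inter_ball_le_mul_ball`:
  `(1 - r²/4)^{d/2} μH[d] (B^d(0, r)) ≤ μH[d] (S^d ∩ B(x, r)) ≤ Λ(r)^d (1 - r²/4)^{d/2} μH[d] (B^d(0, r))`
  with `Λ(r) = 1 + √(r² - r⁴/4) / (1 - r²/2) → 1` (`r → 0`): the cap is the cap
  `{⟪x, y⟫ > c}`, `c = 1 - r²/2`, of `SphericalCap.lean`; it projects `1`-Lipschitz ONTO the disc of
  radius `ρ = √(1 - c²) = r √(1 - r²/4)` of `xᗮ` and is the image of that disc under the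
  `Λ`-Lipschitz graph map `capLift` (the tree's `le_euclideanHausdorffMeasure_cap_general`,
  `euclideanHausdorffMeasure_cap_le_general`, stated for `μHE[d]`); discs of `xᗮ ≅ ℝ^d` have
  `μHE[d]`-measure `ω_d ρ^d`; and an inequality between `μHE[d]`-measures (possibly in different
  spaces) is the same inequality between `μH[d]`-measures, because `μHE[d] = a_d • μH[d]` with ONE
  constant `0 < a_d < ∞` on every space (`hausdorffMeasure_le_mul_of_euclidean`,
  `mul_hausdorffMeasure_le_of_euclidean`) — so the unknown value of `a_d` (isodiametric constant,
  a `proof_wanted` in Mathlib) never enters;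
* `tendsto_hausdorffMeasure_unitSphere_inter_ball_div`:
  **`μH[d] (S^d ∩ B(x, r)) / μH[d] (B^d(0, r)) → 1` as `r → 0⁺`** (squeeze);
* `exists_hausdorffMeasure_unitSphere_inter_ball_le_mul_ball`: a uniform domination
  `μH[d] (S^d ∩ B(x, r)) ≤ C μH[d] (B^d(0, r))` for ALL `r > 0` with `C < ∞`
  (`C = 3^d + μH[d](S^d) / μH[d](B^d(0, 1))`);
* `tendsto_hausdorffMeasure_sphere_inter_ball_div_fin`,
  `exists_hausdorffMeasure_sphere_inter_ball_le_fin`: the case `S⁴ ⊂ ℝ⁵ = EuclideanSpace ℝ (Fin 5)`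
  in the spelling `μH[4]`, `∑ i, x i ^ 2 = 1`.

These are the density-one / domination inputs for computing `4`-densities of product measures
`(uniform on S⁴) ⊗ σ` by dominated convergence.

NOT here: the value of `μH[d]` of a cap or a disc (it involves the isodiametric constant), geodesic
balls, higher-order terms of the expansion.

## References

* H. Federer, *Geometric measure theory* (1969), 2.10.11 (Lipschitz images), 3.2.19 (density one of
  rectifiable sets; here the elementary smooth case with explicit constants).
* P. Mattila, *Geometry of sets and measures in Euclidean spaces* (1995), Chapters 4 and 7
  (Hausdorff measures, Lipschitz maps).
-/

noncomputable section

open Set Metric Module Submodule Filter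
open _root_.MeasureTheory _root_.MeasureTheory.Measure
open scoped ENNReal NNReal Topology RealInnerProductSpace

namespace Literature.MeasureTheory.Hausdorff

/-! ### Inequalities transfer from `μHE[d]` to `μH[d]` -/

section Transfer

variable {X : Type*} [EMetricSpace X] [MeasurableSpace X] [BorelSpace X]
  {Y : Type*} [EMetricSpace Y] [MeasurableSpace Y] [BorelSpace Y]

/-- **`μHE`-inequalities are `μH`-inequalities**: if `μHE[d] s ≤ C · μHE[d] t` for sets `s`, `t` of
two (e)metric Borel spaces, then `μH[d] s ≤ C · μH[d] t` (`μHE[d] = a_d • μH[d]` on every space with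
the same constant `a_d ≠ 0, ∞`). [folklore] -/
theorem hausdorffMeasure_le_mul_of_euclidean (d : ℕ) {s : Set X} {t : Set Y} {C : ℝ≥0∞}
    (h : (μHE[d] : Measure X) s ≤ C * (μHE[d] : Measure Y) t) :
    μH[d] s ≤ C * μH[d] t := by
  have ha0 : ((addHaarScalarFactor (volume : Measure (EuclideanSpace ℝ (Fin d))) μH[d] : ℝ≥0) :
      ℝ≥0∞) ≠ 0 :=
    ENNReal.coe_ne_zero.2 (addHaarScalarFactor_volume_hausdorffMeasure_ne_zero d)
  simp only [euclideanHausdorffMeasure_def, Measure.smul_apply, ENNReal.smul_def, smul_eq_mul]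
    at h
  rw [mul_left_comm C] at h
  exact (ENNReal.mul_le_mul_iff_right ha0 ENNReal.coe_ne_top).1 h

/-- **`μHE`-inequalities are `μH`-inequalities**: if `C · μHE[d] s ≤ μHE[d] t` for sets `s`, `t` of
two (e)metric Borel spaces, then `C · μH[d] s ≤ μH[d] t`. [folklore] -/
theorem mul_hausdorffMeasure_le_of_euclidean (d : ℕ) {s : Set X} {t : Set Y} {C : ℝ≥0∞}
    (h : C * (μHE[d] : Measure X) s ≤ (μHE[d] : Measure Y) t) :
    C * μH[d] s ≤ μH[d] t := by
  have ha0 : ((addHaarScalarFactor (volume : Measure (EuclideanSpace ℝ (Fin d))) μH[d] : ℝ≥0) :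
      ℝ≥0∞) ≠ 0 :=
    ENNReal.coe_ne_zero.2 (addHaarScalarFactor_volume_hausdorffMeasure_ne_zero d)
  simp only [euclideanHausdorffMeasure_def, Measure.smul_apply, ENNReal.smul_def, smul_eq_mul]
    at h
  rw [mul_left_comm C] at h
  exact (ENNReal.mul_le_mul_iff_right ha0 ENNReal.coe_ne_top).1 h

end Transfer

/-! ### Caps versus flat discs -/

/-- The planar radius of a chordal cap: `√(r² - r⁴/4) = r √(1 - r²/4)` for `r ≥ 0`. [folklore] -/
theorem sqrt_sq_sub_fourth_div_four {r : ℝ} (hr : 0 ≤ r) :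
    Real.sqrt (r ^ 2 - r ^ 4 / 4) = r * Real.sqrt (1 - r ^ 2 / 4) := by
  rw [show r ^ 2 - r ^ 4 / 4 = r ^ 2 * (1 - r ^ 2 / 4) by ring, Real.sqrt_mul (sq_nonneg r),
    Real.sqrt_sq hr]

/-- The flat disc rescaled: `(1 - r²/4)^{d/2} · μHE[d] (B^d(0, r)) = ω_d ρ^d` with
`ρ = √(r² - r⁴/4)` the planar radius of the chordal cap of radius `r` (`μHE[d] (B^d(0, r)) = ω_d r^d`
on `EuclideanSpace ℝ (Fin d)`). [folklore] -/
theorem ofReal_mul_euclideanHausdorffMeasure_ball_fin {d : ℕ} (hd : 0 < d) {r : ℝ} (hr : 0 ≤ r) :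
    ENNReal.ofReal (Real.sqrt (1 - r ^ 2 / 4) ^ d) *
        (μHE[d] : Measure (EuclideanSpace ℝ (Fin d))) (ball 0 r) =
      ENNReal.ofReal (Real.sqrt (r ^ 2 - r ^ 4 / 4)) ^ d *
        ENNReal.ofReal (Real.sqrt Real.pi ^ d / Real.Gamma ((d : ℝ) / 2 + 1)) := by
  rw [euclideanHausdorffMeasure_ball_of_finrank (K := EuclideanSpace ℝ (Fin d))
    finrank_euclideanSpace_fin hd 0 r, ← mul_assoc, ← ENNReal.ofReal_pow hr,
    ← ENNReal.ofReal_mul (by positivity), ← mul_pow, mul_comm (Real.sqrt _) r,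
    ← sqrt_sq_sub_fourth_div_four hr, ENNReal.ofReal_pow (Real.sqrt_nonneg _)]

/-- The Lipschitz constant `Λ(r) = 1 + √(r² - r⁴/4) / (1 - r²/2)` of the graph map over the disc of
a chordal cap of radius `r` is nonnegative (`r² < 2`). [folklore] -/
theorem capGraphConst_nonneg {r : ℝ} (hr2 : r ^ 2 < 2) :
    0 ≤ 1 + Real.sqrt (r ^ 2 - r ^ 4 / 4) / (1 - r ^ 2 / 2) :=
  add_nonneg zero_le_one (div_nonneg (Real.sqrt_nonneg _) (by linarith))

section Cap

variable {E : Type*} [NormedAddCommGroup E] [InnerProductSpace ℝ E] [FiniteDimensional ℝ E]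
  [MeasurableSpace E] [BorelSpace E]

/-- **Caps of the unit sphere in chordal balls are thin Lipschitz graphs, `μHE` version**: in a
`(d+1)`-dimensional real inner product space (`d ≥ 1`), for `‖x‖ = 1`, `0 < r`, `r² < 2`,
`μHE[d] ({‖y‖ = 1} ∩ B(x, r)) ≤ Λ^d ω_d ρ^d` with `ρ = √(r² - r⁴/4)`,
`Λ = 1 + ρ / (1 - r²/2)` (the cap is `{⟪x, y⟫ > 1 - r²/2}`, a `Λ`-Lipschitz graph over the disc of
radius `ρ` of `xᗮ`; the tree's `euclideanHausdorffMeasure_cap_le_general`). [folklore] -/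
theorem euclideanHausdorffMeasure_unitSphere_inter_ball_le {d : ℕ} (hE : finrank ℝ E = d + 1)
    (hd : 0 < d) {x : E} (hx : ‖x‖ = 1) {r : ℝ} (hr : 0 < r) (hr2 : r ^ 2 < 2) :
    (μHE[d] : Measure E) (sphere (0 : E) 1 ∩ ball x r) ≤
      ENNReal.ofReal ((1 + Real.sqrt (r ^ 2 - r ^ 4 / 4) / (1 - r ^ 2 / 2)) ^ d) *
        (ENNReal.ofReal (Real.sqrt (r ^ 2 - r ^ 4 / 4)) ^ d *
          ENNReal.ofReal (Real.sqrt Real.pi ^ d / Real.Gamma ((d : ℝ) / 2 + 1))) := by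
  haveI : Fact (finrank ℝ E = d + 1) := ⟨hE⟩
  have hx0 : x ≠ 0 := fun h => by simp [h] at hx
  have hK : finrank ℝ (ℝ ∙ x)ᗮ = d := finrank_orthogonal_span_singleton hx0
  have hc0 : 0 < 1 - r ^ 2 / 2 := by linarith
  have hc1 : 1 - r ^ 2 / 2 < 1 := by nlinarith
  have hρ : r ^ 2 - r ^ 4 / 4 = 1 - (1 - r ^ 2 / 2) ^ 2 := by ring
  rw [unitSphere_inter_ball_eq_cap hx hr, hρ]
  exact euclideanHausdorffMeasure_cap_le_general hx hK hd hc0 hc1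

/-- **Lower comparison of a chordal cap of `S^d` with the flat `d`-disc, for Mathlib's `μH[d]`**:
for `‖x‖ = 1`, `0 < r`, `r² < 2`,
`(1 - r²/4)^{d/2} · μH[d] (B^d(0, r)) ≤ μH[d] ({‖y‖ = 1} ∩ B(x, r))`, the disc `B^d(0, r)` taken in
`EuclideanSpace ℝ (Fin d)` (projection onto `xᗮ`, transfer `μHE ↝ μH`). [folklore] -/
theorem mul_hausdorffMeasure_ball_le_unitSphere_inter_ball {d : ℕ} (hE : finrank ℝ E = d + 1)
    (hd : 0 < d) {x : E} (hx : ‖x‖ = 1) {r : ℝ} (hr : 0 < r) (hr2 : r ^ 2 < 2) :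
    ENNReal.ofReal (Real.sqrt (1 - r ^ 2 / 4) ^ d) *
        μH[d] (ball (0 : EuclideanSpace ℝ (Fin d)) r) ≤
      μH[d] (sphere (0 : E) 1 ∩ ball x r) := by
  have h := le_euclideanHausdorffMeasure_unitSphere_inter_ball hE hd hx hr hr2
  rw [← ofReal_mul_euclideanHausdorffMeasure_ball_fin hd hr.le] at h
  exact mul_hausdorffMeasure_le_of_euclidean d h

/-- **Upper comparison of a chordal cap of `S^d` with the flat `d`-disc, for Mathlib's `μH[d]`**:
for `‖x‖ = 1`, `0 < r`, `r² < 2`,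
`μH[d] ({‖y‖ = 1} ∩ B(x, r)) ≤ Λ(r)^d (1 - r²/4)^{d/2} · μH[d] (B^d(0, r))`,
`Λ(r) = 1 + √(r² - r⁴/4) / (1 - r²/2)`, the disc taken in `EuclideanSpace ℝ (Fin d)` (Lipschitz
graph over the disc of `xᗮ`, transfer `μHE ↝ μH`). [folklore] -/
theorem hausdorffMeasure_unitSphere_inter_ball_le_mul_ball {d : ℕ} (hE : finrank ℝ E = d + 1)
    (hd : 0 < d) {x : E} (hx : ‖x‖ = 1) {r : ℝ} (hr : 0 < r) (hr2 : r ^ 2 < 2) :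
    μH[d] (sphere (0 : E) 1 ∩ ball x r) ≤
      ENNReal.ofReal ((1 + Real.sqrt (r ^ 2 - r ^ 4 / 4) / (1 - r ^ 2 / 2)) ^ d *
          Real.sqrt (1 - r ^ 2 / 4) ^ d) *
        μH[d] (ball (0 : EuclideanSpace ℝ (Fin d)) r) := by
  have h := euclideanHausdorffMeasure_unitSphere_inter_ball_le hE hd hx hr hr2
  rw [← ofReal_mul_euclideanHausdorffMeasure_ball_fin hd hr.le, ← mul_assoc,
    ← ENNReal.ofReal_mul (pow_nonneg (capGraphConst_nonneg hr2) d)] at h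
  exact hausdorffMeasure_le_mul_of_euclidean d h

/-- **Small caps of `S^d` are asymptotically flat `d`-discs, for Mathlib's `μH[d]`**: for `‖x‖ = 1`
in a `(d+1)`-dimensional real inner product space (`d ≥ 1`),
`μH[d] ({‖y‖ = 1} ∩ B(x, r)) / μH[d] (B^d(0, r)) → 1` as `r → 0⁺`, the disc `B^d(0, r)` taken in
`EuclideanSpace ℝ (Fin d)` (squeeze between `(1 - r²/4)^{d/2}` and `Λ(r)^d (1 - r²/4)^{d/2}`, both
`→ 1`); cf. Federer 1969, 3.2.19 (`H^d⌊S^d` has density one everywhere, with explicit rate).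
[folklore] -/
theorem tendsto_hausdorffMeasure_unitSphere_inter_ball_div {d : ℕ} (hE : finrank ℝ E = d + 1)
    (hd : 0 < d) {x : E} (hx : ‖x‖ = 1) :
    Tendsto (fun r : ℝ => μH[d] (sphere (0 : E) 1 ∩ ball x r) /
      μH[d] (ball (0 : EuclideanSpace ℝ (Fin d)) r)) (𝓝[>] 0) (𝓝 1) := by
  have hg : Tendsto (fun r : ℝ => ENNReal.ofReal (Real.sqrt (1 - r ^ 2 / 4) ^ d)) (𝓝[>] 0)
      (𝓝 1) := by
    have hc : ContinuousAt (fun r : ℝ => Real.sqrt (1 - r ^ 2 / 4) ^ d) 0 := by fun_prop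
    have h := ENNReal.tendsto_ofReal hc.tendsto
    have h1 : ENNReal.ofReal (Real.sqrt (1 - (0 : ℝ) ^ 2 / 4) ^ d) = 1 := by norm_num
    rw [h1] at h
    exact h.mono_left nhdsWithin_le_nhds
  have hh : Tendsto (fun r : ℝ => ENNReal.ofReal
      ((1 + Real.sqrt (r ^ 2 - r ^ 4 / 4) / (1 - r ^ 2 / 2)) ^ d * Real.sqrt (1 - r ^ 2 / 4) ^ d))
      (𝓝[>] 0) (𝓝 1) := by
    have hc : ContinuousAt (fun r : ℝ =>
        (1 + Real.sqrt (r ^ 2 - r ^ 4 / 4) / (1 - r ^ 2 / 2)) ^ d * Real.sqrt (1 - r ^ 2 / 4) ^ d)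
        0 := by
      fun_prop (disch := norm_num)
    have h := ENNReal.tendsto_ofReal hc.tendsto
    have h1 : ENNReal.ofReal ((1 + Real.sqrt ((0 : ℝ) ^ 2 - (0 : ℝ) ^ 4 / 4) /
        (1 - (0 : ℝ) ^ 2 / 2)) ^ d * Real.sqrt (1 - (0 : ℝ) ^ 2 / 4) ^ d) = 1 := by norm_num
    rw [h1] at h
    exact h.mono_left nhdsWithin_le_nhds
  refine tendsto_of_tendsto_of_tendsto_of_le_of_le' hg hh ?_ ?_
  · filter_upwards [Ioo_mem_nhdsGT zero_lt_one] with r hr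
    have hB0 : μH[d] (ball (0 : EuclideanSpace ℝ (Fin d)) r) ≠ 0 := (measure_ball_pos _ 0 hr.1).ne'
    have hBt : μH[d] (ball (0 : EuclideanSpace ℝ (Fin d)) r) ≠ ⊤ := measure_ball_lt_top.ne
    rw [ENNReal.le_div_iff_mul_le (Or.inl hB0) (Or.inl hBt)]
    exact mul_hausdorffMeasure_ball_le_unitSphere_inter_ball hE hd hx hr.1 (by nlinarith [hr.1, hr.2])
  · filter_upwards [Ioo_mem_nhdsGT zero_lt_one] with r hr
    have hB0 : μH[d] (ball (0 : EuclideanSpace ℝ (Fin d)) r) ≠ 0 := (measure_ball_pos _ 0 hr.1).ne'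
    have hBt : μH[d] (ball (0 : EuclideanSpace ℝ (Fin d)) r) ≠ ⊤ := measure_ball_lt_top.ne
    rw [ENNReal.div_le_iff_le_mul (Or.inl hB0) (Or.inl hBt)]
    exact hausdorffMeasure_unitSphere_inter_ball_le_mul_ball hE hd hx hr.1 (by nlinarith [hr.1, hr.2])

/-- **Uniform domination of caps by flat discs, for Mathlib's `μH[d]`**: for `‖x‖ = 1` in a
`(d+1)`-dimensional real inner product space (`d ≥ 1`) there is `C < ∞` with
`μH[d] ({‖y‖ = 1} ∩ B(x, r)) ≤ C · μH[d] (B^d(0, r))` for EVERY `r > 0`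
(`C = 3^d + μH[d](S^d) / μH[d](B^d(0,1))`: for `r ≤ 1` the upper comparison with `Λ ≤ 3`, for
`r ≥ 1` the whole sphere, of finite measure, against the monotone disc). [folklore] -/
theorem exists_hausdorffMeasure_unitSphere_inter_ball_le_mul_ball {d : ℕ}
    (hE : finrank ℝ E = d + 1) (hd : 0 < d) {x : E} (hx : ‖x‖ = 1) :
    ∃ C : ℝ≥0∞, C < ⊤ ∧ ∀ r : ℝ, 0 < r →
      μH[d] (sphere (0 : E) 1 ∩ ball x r) ≤ C * μH[d] (ball (0 : EuclideanSpace ℝ (Fin d)) r) := by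
  set S := μH[d] (sphere (0 : E) 1) with hS_def
  set b := μH[d] (ball (0 : EuclideanSpace ℝ (Fin d)) 1) with hb_def
  have hS : S < ⊤ := hausdorffMeasure_unitSphere_lt_top hE
  have hb0 : b ≠ 0 := (measure_ball_pos _ 0 one_pos).ne'
  have hbt : b ≠ ⊤ := measure_ball_lt_top.ne
  refine ⟨3 ^ d + S / b, ENNReal.add_lt_top.2 ⟨ENNReal.pow_lt_top (by simp),
    ENNReal.div_lt_top hS.ne hb0⟩, fun r hr => ?_⟩
  rcases le_or_gt r 1 with hr1 | hr1
  · have hr2 : r ^ 2 < 2 := by nlinarith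
    have h := hausdorffMeasure_unitSphere_inter_ball_le_mul_ball hE hd hx hr hr2
    refine h.trans (mul_le_mul' (le_trans ?_ le_self_add) le_rfl)
    have hs1 : Real.sqrt (r ^ 2 - r ^ 4 / 4) ≤ 1 := Real.sqrt_le_one.2 (by nlinarith)
    have hΛ : 1 + Real.sqrt (r ^ 2 - r ^ 4 / 4) / (1 - r ^ 2 / 2) ≤ 3 := by
      have h2 : Real.sqrt (r ^ 2 - r ^ 4 / 4) / (1 - r ^ 2 / 2) ≤ 2 := by
        rw [div_le_iff₀ (by nlinarith)]
        nlinarith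
      linarith
    have hq : Real.sqrt (1 - r ^ 2 / 4) ≤ 1 := Real.sqrt_le_one.2 (by nlinarith)
    calc ENNReal.ofReal ((1 + Real.sqrt (r ^ 2 - r ^ 4 / 4) / (1 - r ^ 2 / 2)) ^ d *
            Real.sqrt (1 - r ^ 2 / 4) ^ d)
        ≤ ENNReal.ofReal ((3 : ℝ) ^ d * 1 ^ d) := by
          refine ENNReal.ofReal_le_ofReal (mul_le_mul ?_ ?_ (by positivity) (by positivity))
          · exact pow_le_pow_left₀ (capGraphConst_nonneg hr2) hΛ d
          · exact pow_le_pow_left₀ (Real.sqrt_nonneg _) hq d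
      _ = 3 ^ d := by
          rw [one_pow, mul_one, ENNReal.ofReal_pow (by norm_num), ENNReal.ofReal_ofNat]
  · calc μH[d] (sphere (0 : E) 1 ∩ ball x r) ≤ S := measure_mono inter_subset_left
      _ = S / b * b := (ENNReal.div_mul_cancel hb0 hbt).symm
      _ ≤ (3 ^ d + S / b) * μH[d] (ball (0 : EuclideanSpace ℝ (Fin d)) r) :=
          mul_le_mul' le_add_self (measure_mono (ball_subset_ball hr1.le))

end Cap

/-! ### The unit `4`-sphere of `ℝ⁵` -/

/-- On `EuclideanSpace ℝ (Fin n)`, `∑ i, x i ^ 2 = 1` says `‖x‖ = 1`. [folklore] -/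
theorem norm_eq_one_of_sum_sq_eq_one {n : ℕ} {x : EuclideanSpace ℝ (Fin n)}
    (hx : ∑ i, x i ^ 2 = 1) : ‖x‖ = 1 := by
  have h2 : ‖x‖ ^ 2 = 1 := by rw [EuclideanSpace.real_norm_sq_eq, hx]
  have h0 := norm_nonneg x
  nlinarith

/-- **Small caps of the unit `S⁴ ⊂ ℝ⁵` are asymptotically flat `4`-discs, for Mathlib's `μH[4]`**:
for `∑ i, x i ^ 2 = 1`, `μH[4] (S⁴ ∩ B(x, ρ)) / μH[4] (B⁴(0, ρ)) → 1` as `ρ → 0⁺`, the disc taken in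
`EuclideanSpace ℝ (Fin 4)`. [folklore] -/
theorem tendsto_hausdorffMeasure_sphere_inter_ball_div_fin {x : EuclideanSpace ℝ (Fin 5)}
    (hx : ∑ i, x i ^ 2 = 1) :
    Tendsto (fun ρ : ℝ => μH[4] (sphere (0 : EuclideanSpace ℝ (Fin 5)) 1 ∩ ball x ρ) /
      μH[4] (ball (0 : EuclideanSpace ℝ (Fin 4)) ρ)) (𝓝[>] 0) (𝓝 1) :=
  tendsto_hausdorffMeasure_unitSphere_inter_ball_div (E := EuclideanSpace ℝ (Fin 5)) (d := 4)
    finrank_euclideanSpace_fin (by norm_num) (norm_eq_one_of_sum_sq_eq_one hx)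

/-- **Uniform domination of the caps of the unit `S⁴ ⊂ ℝ⁵` by flat `4`-discs, for Mathlib's
`μH[4]`**: for `∑ i, x i ^ 2 = 1` there is `C < ∞` with `μH[4] (S⁴ ∩ B(x, ρ)) ≤ C · μH[4] (B⁴(0, ρ))`
for every `ρ > 0`. [folklore] -/
theorem exists_hausdorffMeasure_sphere_inter_ball_le_fin {x : EuclideanSpace ℝ (Fin 5)}
    (hx : ∑ i, x i ^ 2 = 1) :
    ∃ C : ℝ≥0∞, C < ⊤ ∧ ∀ ρ : ℝ, 0 < ρ →
      μH[4] (sphere (0 : EuclideanSpace ℝ (Fin 5)) 1 ∩ ball x ρ) ≤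
        C * μH[4] (ball (0 : EuclideanSpace ℝ (Fin 4)) ρ) :=
  exists_hausdorffMeasure_unitSphere_inter_ball_le_mul_ball (E := EuclideanSpace ℝ (Fin 5)) (d := 4)
    finrank_euclideanSpace_fin (by norm_num) (norm_eq_one_of_sum_sq_eq_one hx)

end Literature.MeasureTheory.Hausdorff

end
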